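import Literature.AlgebraicGeometry.Frobenioids.ModelFrobenioidUnits
import Literature.AlgebraicGeometry.Frobenioids.ModelFrobenioidPreFrobenioid
import HarnessLib

/-!
# Frobenioids I, Theorem 5.2 (i): the conjugation action of `Aut_C(A)` on `O^▷(A)`, `O^×(A)` in a model
# Frobenioid is the PULL-BACK action of `Base(−)` (proof-only)

Mochizuki, *The geometry of Frobenioids I: the general theory*, Kyushu J. Math. **62** (2008)
293–400, §5, Theorem 5.2 (i), kurims p. 100 [cite: MochizukiFrdI2008, Thm. 5.2 (i) p.100]: a morphism
`φ : (A_D, α) → (B_D, β)` of the model Frobenioid `C` of `(Φ, B, Div_B)` is a quadruple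
`(deg_Fr(φ), Base(φ), Div(φ), u_φ)` with the composition law of Thm. 5.2 (i)
`(deg_Fr(ψ)·deg_Fr(φ), Base(ψ) ∘ Base(φ), Base(φ)^*Div(ψ) + deg_Fr(ψ)·Div(φ), Base(φ)^*u_ψ + deg_Fr(ψ)·u_φ)`.

CONSEQUENCE (elementary, kernel-checked here; used by [EtTh] Thm. 3.7 (iii) "the natural action of
`Aut_C(A)` on `O^▷(A)`, `O^×(A)` factors through [the base]" for tempered Frobenioids, and parallel to
[FrdII] Thm. 3.6 (iv) for archimedean ones, `ArchimedeanAutActionFactors.lean`): for an automorphism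
`α` of `X = (A_D, a)` and a base-identity linear endomorphism `f = (1, id, Div(f), u_f) ∈ O^▷(X)`,
the conjugate `α⁻¹ ∘ f ∘ α` (diagrammatic `α.inv ≫ f ≫ α.hom`) is
`(1, id, Base(α⁻¹)^* Div(f), Base(α⁻¹)^* u_f)` — the twists `u_α`, `Div(α)` CANCEL (`Φ(A_D)`, `B(A_D)`
commutative), so the action of `Aut_C(X)` on `O^▷(X)` and `O^×(X)` depends on `α` only through
`Base(α) ∈ Aut_D(A_D)`:

* `unit_conj'`, `div_conj'`, `baseMap_conj'`, `degFr_conj'` — the four components of the conjugate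
  `α.inv ≫ f ≫ α.hom` (the convention of the `α.symm ≪≫ u ≪≫ α` actions in [FrdII] Thm. 3.6 (iv)'s
  schema; the primed names avoid the `α.hom ≫ f ≫ α.inv` lemmas `unit_conj` etc. of
  `ModelFrobenioidAmpleness.lean`, seat abc-iut-L1-d10, [FrdII] Thm. 1.2 (ii), which give the finer
  factorisation through the ACTION of `Base(α)` on `Φ(A_D)`, `B(A_D)` — `conj_eq_conj_of_map_eq`);
* `conj_eq_of_baseMap_eq`, `autAction_factorsThroughBase` — automorphisms with the same image in
  `Aut_D(A_D)` act identically on `O^▷(X)` and on `O^×(X)` (both in the tree's `PreFrobenioid.endSubmonoid`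
  / `PreFrobenioid.unitsSubgroup` form for the functor `C → F_Φ` of Thm. 5.2 (i));
* `aut_eq_of_baseMap_eq_of_unit_eq` — for `Φ` divisorial, an automorphism is determined by
  `(Base(α), u_α)` (`deg_Fr(α) = 1`, `Div(α) = 0`).
No definitions; no statement of the paper is strengthened.
-/

noncomputable section

namespace Literature.AlgebraicGeometry.Frobenioids

namespace ModelFrobenioid

open CategoryTheory Opposite

universe w v u

variable {D : Type u} [Category.{v} D] {Φ B : Dᵒᵖ ⥤ CommMonCat.{w}} {DivB : B ⟶ monoidGp Φ}
  {X : ModelFrobenioid Φ B DivB}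

/-! ### Components of an automorphism and of its inverse -/

/-- `Base(α⁻¹) ∘ Base(α) = id` (diagrammatic `Base(α.inv) ≫ Base(α.hom) = 𝟙`).
[cite: MochizukiFrdI2008, Thm. 5.2 (i) p.100] -/
theorem baseMap_inv_comp_hom (α : X ≅ X) : baseMap α.inv ≫ baseMap α.hom = 𝟙 X.base := by
  rw [← baseMap_comp, α.inv_hom_id, baseMap_id]

/-- `Base(α) ∘ Base(α⁻¹) = id`. [cite: MochizukiFrdI2008, Thm. 5.2 (i) p.100] -/
theorem baseMap_hom_comp_inv (α : X ≅ X) : baseMap α.hom ≫ baseMap α.inv = 𝟙 X.base := by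
  rw [← baseMap_comp, α.hom_inv_id, baseMap_id]

/-- Two automorphisms with the same `Base(α)` have the same `Base(α⁻¹)`.
[cite: MochizukiFrdI2008, Thm. 5.2 (i) p.100] -/
theorem baseMap_inv_eq_of_baseMap_hom_eq {α α' : X ≅ X} (h : baseMap α.hom = baseMap α'.hom) :
    baseMap α.inv = baseMap α'.inv := by
  calc baseMap α.inv = baseMap α.inv ≫ (baseMap α'.hom ≫ baseMap α'.inv) := by
        rw [baseMap_hom_comp_inv, Category.comp_id]
    _ = (baseMap α.inv ≫ baseMap α.hom) ≫ baseMap α'.inv := by rw [← h, Category.assoc]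
    _ = baseMap α'.inv := by rw [baseMap_inv_comp_hom, Category.id_comp]

/-- `Base(α⁻¹)^* u_α · u_{α⁻¹} = 1` in `B(A_D)` (read off `α⁻¹ ∘ α = id`, `deg_Fr(α) = 1`).
[cite: MochizukiFrdI2008, Thm. 5.2 (i) p.100] -/
theorem pull_unit_hom_mul_unit_inv (α : X ≅ X) :
    pull B (baseMap α.inv) (unit α.hom) * unit α.inv = 1 := by
  have h := congrArg unit α.inv_hom_id
  rw [unit_comp_pull, unit_id, (degFr_hom_eq_one α).1, PNat.one_coe, pow_one] at h
  exact h

/-- `Base(α⁻¹)^* Div(α) + Div(α⁻¹) = 0` in `Φ(A_D)`. [cite: MochizukiFrdI2008, Thm. 5.2 (i) p.100] -/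
theorem pull_div_hom_mul_div_inv (α : X ≅ X) :
    pull Φ (baseMap α.inv) (div α.hom) * div α.inv = 1 := by
  have h := congrArg div α.inv_hom_id
  rw [div_comp_pull, div_id, (degFr_hom_eq_one α).1, PNat.one_coe, pow_one] at h
  exact h

/-! ### The conjugate of a base-identity linear endomorphism -/

section Conj

variable (α : X ≅ X) {f : X ⟶ X} (hfb : baseMap f = 𝟙 X.base) (hfd : degFr f = 1)
include hfb hfd

omit hfb in
/-- `deg_Fr(α⁻¹ ∘ f ∘ α) = 1`. [cite: MochizukiFrdI2008, Thm. 5.2 (i) p.100] -/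
theorem degFr_conj' : degFr (α.inv ≫ f ≫ α.hom) = 1 := by
  rw [degFr_comp, degFr_comp, (degFr_hom_eq_one α).1, (degFr_hom_eq_one α).2, hfd, mul_one, mul_one]

omit hfd in
/-- `Base(α⁻¹ ∘ f ∘ α) = id`. [cite: MochizukiFrdI2008, Thm. 5.2 (i) p.100] -/
theorem baseMap_conj' : baseMap (α.inv ≫ f ≫ α.hom) = 𝟙 X.base := by
  rw [baseMap_comp, baseMap_comp, hfb, Category.id_comp, baseMap_inv_comp_hom]

/-- **`u_{α⁻¹ ∘ f ∘ α} = Base(α⁻¹)^* u_f`** — the twist `u_α` cancels (`B(A_D)` commutative).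
[cite: MochizukiFrdI2008, Thm. 5.2 (i) p.100] -/
theorem unit_conj' : unit (α.inv ≫ f ≫ α.hom) = pull B (baseMap α.inv) (unit f) := by
  rw [unit_comp_pull, unit_comp_pull, hfb, degFr_comp, hfd, (degFr_hom_eq_one α).1, mul_one,
    PNat.one_coe, pow_one, pow_one, pull_id, map_mul, mul_right_comm, pull_unit_hom_mul_unit_inv,
    one_mul]

/-- **`Div(α⁻¹ ∘ f ∘ α) = Base(α⁻¹)^* Div(f)`** — the term `Div(α)` cancels.
[cite: MochizukiFrdI2008, Thm. 5.2 (i) p.100] -/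
theorem div_conj' : div (α.inv ≫ f ≫ α.hom) = pull Φ (baseMap α.inv) (div f) := by
  rw [div_comp_pull, div_comp_pull, hfb, degFr_comp, hfd, (degFr_hom_eq_one α).1, mul_one,
    PNat.one_coe, pow_one, pow_one, pull_id, map_mul, mul_right_comm, pull_div_hom_mul_div_inv,
    one_mul]

end Conj

/-- The conjugate `α⁻¹ ∘ f ∘ α` of a base-identity linear endomorphism `f` depends on `α` only through
`Base(α)`: automorphisms `α, α'` with `Base(α) = Base(α')` give the same conjugate.
[cite: MochizukiFrdI2008, Thm. 5.2 (i) p.100] -/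
theorem conj_eq_of_baseMap_eq {α α' : X ≅ X} (h : baseMap α.hom = baseMap α'.hom) {f : X ⟶ X}
    (hfb : baseMap f = 𝟙 X.base) (hfd : degFr f = 1) :
    α.inv ≫ f ≫ α.hom = α'.inv ≫ f ≫ α'.hom := by
  have hinv := baseMap_inv_eq_of_baseMap_hom_eq h
  refine hom_ext ?_ ?_ ?_ ?_
  · rw [degFr_conj' α hfd, degFr_conj' α' hfd]
  · rw [baseMap_conj' α hfb, baseMap_conj' α' hfb]
  · rw [div_conj' α hfb hfd, div_conj' α' hfb hfd, hinv]
  · rw [unit_conj' α hfb hfd, unit_conj' α' hfb hfd, hinv]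

variable (X) in
/-- **The action of `Aut_C(X)` on `O^▷(X)` and on `O^×(X)` factors through `Base : Aut_C(X) → Aut_D(A_D)`**
([FrdI] Def. 1.2 (ii) `O^▷`, `O^×` for the functor `C → F_Φ` of Thm. 5.2 (i); the Frobenioid-side
half of [EtTh] Thm. 3.7 (iii) and of [FrdII] Thm. 1.2 (ii) / 3.6 (iv)): automorphisms with the same
`Base` act identically by conjugation. [cite: MochizukiFrdI2008, Thm. 5.2 (i) p.100] -/
theorem autAction_factorsThroughBase (α α' : X ≅ X) (h : baseMap α.hom = baseMap α'.hom) :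
    (∀ f ∈ PreFrobenioid.endSubmonoid (toElem Φ B DivB) X, α.inv ≫ f ≫ α.hom = α'.inv ≫ f ≫ α'.hom) ∧
      ∀ u ∈ PreFrobenioid.unitsSubgroup (toElem Φ B DivB) X, α.symm ≪≫ u ≪≫ α = α'.symm ≪≫ u ≪≫ α' := by
  refine ⟨fun f hf => conj_eq_of_baseMap_eq h hf.1 hf.2, fun u hu => ?_⟩
  apply Iso.ext
  change α.inv ≫ u.hom ≫ α.hom = α'.inv ≫ u.hom ≫ α'.hom
  exact conj_eq_of_baseMap_eq h hu.1 hu.2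

/-- For `Φ` divisorial (hence sharp), an automorphism `α` of an object of the model Frobenioid is
DETERMINED by the pair `(Base(α), u_α)`: `deg_Fr(α) = 1` and `Div(α) = 0` automatically.
[cite: MochizukiFrdI2008, Thm. 5.2 (i) p.100] -/
theorem aut_eq_of_baseMap_eq_of_unit_eq (hΦd : Objectwise (fun M _ => IsDivisorial M) Φ)
    {α α' : X ≅ X} (hb : baseMap α.hom = baseMap α'.hom) (hu : unit α.hom = unit α'.hom) : α = α' := by
  apply Iso.ext
  refine hom_ext ?_ hb ?_ hu
  · rw [(degFr_hom_eq_one α).1, (degFr_hom_eq_one α').1]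
  · rw [div_eq_one_of_isIso hΦd α.hom, div_eq_one_of_isIso hΦd α'.hom]

/-- Hence `α ↦ (Base(α), u_α)`, `Aut_C(X) → Aut_D(A_D) × B(A_D)`, is injective (for `Φ` divisorial).
[cite: MochizukiFrdI2008, Thm. 5.2 (i) p.100] -/
theorem injective_baseMap_unit (hΦd : Objectwise (fun M _ => IsDivisorial M) Φ) :
    Function.Injective fun α : X ≅ X => (baseMap α.hom, unit α.hom) := by
  intro α α' h
  simp only [Prod.mk.injEq] at h
  exact aut_eq_of_baseMap_eq_of_unit_eq hΦd h.1 h.2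

end ModelFrobenioid

end Literature.AlgebraicGeometry.Frobenioids
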